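import Literature.AlgebraicGeometry.Motives.GaloisActionSemisimpleKunnethProducts
import Literature.AlgebraicGeometry.Motives.LangWeilEstimateOfRiemannHypothesis
import Literature.AlgebraicGeometry.Motives.ZetaFunctionOfProductKunnethFormula
import Literature.Algebra.Polynomial.RootProductsResultant
import Literature.NumberTheory.LFunctions.WeilFactorizationOfPointCountFormula
import HarnessLib

/-!
# The Künneth formula for the Frobenius: `tr(Fᵐ | Hᵈ(X × Y)) = Σ_{i+j=d} tr(Fᵐ | Hⁱ(X)) tr(Fᵐ | Hʲ(Y))`,
# `P_d(X × Y, T) = ∏_{i+j=d} det(1 − T·Fᵢ ⊗ F'ⱼ) = ∏_{i+j=d} Pᵢ(X) ⊙ Pⱼ(Y)`, and the Riemann hypothesis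
# for `X × Y` from the Riemann hypothesis for `X` and for `Y`

Topic `Literature/AlgebraicGeometry/Motives`; THEOREMS ONLY (no definition, no instance, no named fact;
D-0026).  For a Galois Weil cohomology theory `E` (Künneth isomorphism (B) of the underlying Weil
cohomology theory, `WeilCohomology.kunnethEquiv`, and the Galois-equivariance of the external product,
`GaloisWeilCohomology.ρ_comp_extTensor`) the Frobenius `F = ρ(φ⁻¹)` of `Hᵈ(X ×ₖ Y)` is the direct sum of the
`Fᵢ ⊗ F'ⱼ` on the Künneth pieces `Hⁱ(X) ⊗ Hʲ(Y)`, `i + j = d`.  Consequences recorded here: the trace formula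
for `Fᵐ`, the product formula for `P_d(X × Y, T) = det(1 − T·F | Hᵈ(X × Y))`, integral models of the
`P_d(X × Y)` as composed multiplications `∏_{i+j=d} Pᵢ(X) ⊙ Pⱼ(Y)` of integral models of the factors (row g45-#1),
and hence **`E.WeilRiemannHypothesisFor X n ∧ E.WeilRiemannHypothesisFor Y n' ⟹
E.WeilRiemannHypothesisFor (X ×ₖ Y) (n + n')`** — the converse of the tree's descent
`weilRiemannHypothesisFor_of_tensor` (`FrobeniusDominatedVarieties`), and the discharge of the hypothesis
«`X ×ₖ Y` satisfies the Riemann hypothesis» carried by the Künneth rows of `PointCountsKunnethBettiNumbers` /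
`PointCountsKunnethReciprocalRoots`.

## Sources, verbatim

N. Ramachandran, *Zeta functions, Grothendieck groups, and the Witt ring*, Bull. Sci. Math. 139 (2015)
[Ramachandran2014], second proof of Theorem 2.1 (i): «recall `Z(X,t) = ∏ᵢ det(1 − F*t, Hⁱ_c(X̄, ℚ_ℓ))^{(−1)^{i+1}}`
… `Pᵢ(X,t) = det(1 − F*t, Hⁱ_c(X̄, ℚ_ℓ))`.  We can write `Z(X,t)` in `W(ℚ̄_ℓ)` as a sum `Σ [α_X]` over the (inverse)
eigenvalues `α_X` of Frobenius of `X`.  By the Künneth theorem, any `α_{X×Y}` is a product of a `α_X` and a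
`α_Y`», proof of Theorem 2.6 (c): «in the Künneth decomposition, consider the subspace
`Uᵢ ⊂ Hⁱ_c(X̄, ℚ_ℓ)` … The subspace `Uᵢ` is a sub-`G`-representation … with characteristic polynomial equal to …».
S. Kleiman, *Algebraic cycles and the Weil conjectures* [Kleiman1968AlgebraicCycles], §1.2 (B) (Künneth formula
`H*(X) ⊗ H*(Y) ⥲ H*(X × Y)`).
P. Deligne, *La conjecture de Weil. I* [Deligne1974], (1.5) (functoriality of `F*`), Th. (1.6) («les racines
inverses α de `Pᵢ` … `|α| = q^{i/2}`»).
B. Kahn, *Zeta and L-functions of varieties and motives* [Kahn2020], §3.6 axiom (vi) and (3.6.3).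

## What is here

For `E` a Galois Weil cohomology theory over the finite field `k` (`q = #k`), `X` smooth projective of dimension
`n`, `Y` of dimension `n'` (`Fᵢ = F | Hⁱ(X)`, `F'ⱼ = F | Hʲ(Y)`):
* §1 **`trace_ρ_tensor_eq_sum`**, **`frobTracePow_tensor_eq_sum`**: `tr(ρ(g) | Hᵈ(X × Y)) =
  Σ_{i+j=d} tr(ρ(g) | Hⁱ(X)) tr(ρ(g) | Hʲ(Y))` for every `g ∈ Γ_k`, in particular
  `tr(Fᵐ | Hᵈ(X × Y)) = Σ_{i+j=d} tr(Fᵢᵐ) tr(F'ⱼᵐ)` (`F u = Σ ext((Fᵢ ⊗ F'ⱼ)(u_{ij}))` on Künneth components and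
  `tr(ext ∘ M ∘ comp) = tr(M ∘ comp ∘ ext) = tr(M)`).
* §2 **`frobCharPoly_tensor_eq_prod`**: `P_d(X × Y, T) = ∏_{i+j=d} det(1 − T·Fᵢ ⊗ F'ⱼ)` in `K[T]` (both are
  `exp(−Σ_m tr(Fᵐ) Tᵐ/m)`).
* §3 **`isIntegralModel_tensor`**: integral models `Pᵢ(X)`, `Pⱼ(Y)` (`i ≤ 2n`, `j ≤ 2n'`) give the integral
  models `∏_{i+j=d} Pᵢ(X) ⊙ Pⱼ(Y)` of `P_d(X × Y)` (the composed multiplication of `RootProductsResultant`; the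
  ghost components `tr(Fᵐ | Hᵈ(X × Y)) = Σ sᵢₘ(X) sⱼₘ(Y)` are integers whose complex images are the power sums of
  the products `α β`; `exists_isIntegralModel_tensor`), `norm_eq_of_isRoot_prod_composedMul` (the complex roots of
  `∏_{i+j=d} Pᵢ ⊙ P'ⱼ` have absolute value `q^{−d/2}` when those of `Pᵢ`, `P'ⱼ` have absolute values `q^{−i/2}`,
  `q^{−j/2}`), and hence **`weilRiemannHypothesisFor_tensor`**: the Riemann hypothesis for `X` and `Y` implies the
  Riemann hypothesis for `X ×ₖ Y` («any `α_{X×Y}` is a product of a `α_X` and a `α_Y`», `|αβ| = q^{(i+j)/2}`), and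
  **`isWeilFactorization_tensor`**: under the Lefschetz trace formula, `∏_{i+j=d} Pᵢ(X) ⊙ Pⱼ(Y)` (`d ≤ 2(n+n')`) is
  a Weil factorisation (`IsWeilFactorization`) of `Z(X ×ₖ Y, T)`.
* §4 (degree one, only `χ(φ) = q`): `frobTracePow_tensor_one` (`tr(Fᵐ | H¹(X × Y)) = tr(Fᵐ | H¹(X)) +
  tr(Fᵐ | H¹(Y))`), **`frobCharPoly_tensor_one_eq_mul`** (`P₁(X × Y) = P₁(X) P₁(Y)` in `K[T]`),
  `isIntegralModel_tensor_one_mul` (integral models multiply in degree one).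

HC is not touched.

## References

* [Ramachandran2014] N. Ramachandran, *Zeta functions, Grothendieck groups, and the Witt ring*, Bull. Sci.
  Math. 139 (2015) 599–627 (arXiv:1407.1813), Theorem 2.1 (i) (second proof), Theorem 2.6 (c) (proof).
* [Kleiman1968AlgebraicCycles] S. Kleiman, *Algebraic cycles and the Weil conjectures* (1968), §1.2 (B).
* [Deligne1974] P. Deligne, *La conjecture de Weil. I*, Publ. Math. IHÉS 43 (1974), (1.5), Th. (1.6).
* [Kahn2020] B. Kahn, *Zeta and L-Functions of Varieties and Motives* (2020), §3.6 (vi), (3.6.3).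
* Tree: `GaloisActionSemisimpleKunnethProducts` (`ρ_comp_extTensor`), `AbelianVarietyHopf` (`kunnethComponent`,
  `sum_extTensor_kunnethComponent`, `kunnethComponent_extTensor_self`), `FrobeniusTraceProofs`
  (`frobCharPoly_eq_exp_subst_neg`, `FrobeniusTrace.exp_subst_*`), `ZetaFunctionOfProductKunnethFormula`
  (`FrobeniusTrace.exp_subst_mul_reverse_charpoly_map`), `LangWeilEstimateOfRiemannHypothesis`
  (`exists_int_frobTracePow_succ_eq_sum_roots`), `RootProductsResultant` (g45-#1),
  `WeilFactorizationOfPointCountFormula` (g45-#2: `coe_eq_exp_subst_neg_of_splits`),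
  `WeilConjecturesFactorizationProofs` (`isWeilFactorization_of_isIntegralModel`),
  `FrobeniusDominatedVarieties` (the converse `weilRiemannHypothesisFor_of_tensor`).

## Provenance

Lane `lit-hodgefound` (summit `HodgeConjecture`, Track 2 foundations library, Layer B: motives / zeta functions —
the zeta function of a product `Z(X × Y) = Z(X) ∗ Z(Y)`), seat `lit-hodgefound-p29` (literature-prover,
generation 45, row g45-#6).
-/

universe u v

open PowerSeries TensorProduct CategoryTheory MonoidalCategory
open scoped Polynomial

noncomputable section

namespace Literature.AlgebraicGeometry.Motives

namespace GaloisWeilCohomology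

open FrobeniusTrace
open Literature.Algebra.Polynomial (coeff_zero_composedMul roots_map_composedMul sum_roots_composedMul_inv_pow)
open Literature.NumberTheory.LFunctions (coe_eq_exp_subst_neg_of_splits isWeilFactorization_of_isIntegralModel)

variable {k : Type u} [Field k] [Finite k] {K : Type v} [Field K] [CharZero K]
  {χ : Field.absoluteGaloisGroup k →* Kˣ} (E : GaloisWeilCohomology k K χ)
variable {n n' : ℕ} {X Y : SchemeOver k}

/-! ### §1 The Künneth formula for traces -/

omit [Finite k] in
/-- **`tr(ρ(g) | Hᵈ(X × Y)) = Σ_{i+j=d} tr(ρ(g) | Hⁱ(X)) · tr(ρ(g) | Hʲ(Y))`** for every `g ∈ Γ_k`: on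
`Hᵈ(X × Y) = ⊕_{i+j=d} ext(Hⁱ(X) ⊗ Hʲ(Y))` (Künneth (B)) the Galois action is `Σ ext ∘ (ρ_X(g) ⊗ ρ_Y(g)) ∘ comp`
(equivariance of the external product), and `tr(ext ∘ M ∘ comp) = tr(M ∘ comp ∘ ext) = tr(M) = tr(ρ_X(g)) tr(ρ_Y(g))`
(«the subspace `Uᵢ` is a sub-`G`-representation, with characteristic polynomial …»).
[cite: Ramachandran2014, Theorem 2.1 (i) (second proof) and Theorem 2.6 (c) (proof)] [cite: Kleiman1968AlgebraicCycles, §1.2 (B)] -/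
theorem trace_ρ_tensor_eq_sum (hX : IsSmoothProjective n X) (hY : IsSmoothProjective n' Y) (d : ℕ)
    (g : Field.absoluteGaloisGroup k) :
    LinearMap.trace K (E.obj (X ⊗ Y) d) (E.ρ (X ⊗ Y) d g) =
      ∑ ij : ↥(Finset.HasAntidiagonal.antidiagonal d),
        LinearMap.trace K (E.obj X ij.1.1) (E.ρ X ij.1.1 g) * LinearMap.trace K (E.obj Y ij.1.2) (E.ρ Y ij.1.2 g) := by
  classical
  have hXY : IsSmoothProjective (n + n') (X ⊗ Y) := IsSmoothProjective.tensor_holds hX hY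
  haveI := E.finite_obj hXY d
  -- `ρ(g) = Σ_{ij} ext_{ij} ∘ (ρ_X(g) ⊗ ρ_Y(g)) ∘ comp_{ij}`
  have hdec : E.ρ (X ⊗ Y) d g = ∑ ij : ↥(Finset.HasAntidiagonal.antidiagonal d),
      E.extTensor (X := X) (Y := Y) (Finset.HasAntidiagonal.mem_antidiagonal.mp ij.2) ∘ₗ
        (TensorProduct.map (E.ρ X ij.1.1 g) (E.ρ Y ij.1.2 g) ∘ₗ
          E.kunnethComponent hX hY ij.1.1 ij.1.2 (Finset.HasAntidiagonal.mem_antidiagonal.mp ij.2)) := by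
    refine LinearMap.ext fun u => ?_
    rw [LinearMap.sum_apply]
    conv_lhs => rw [← E.sum_extTensor_kunnethComponent hX hY u, map_sum]
    refine Finset.sum_congr rfl fun ij _ => ?_
    rw [LinearMap.comp_apply, LinearMap.comp_apply, ← LinearMap.comp_apply (E.ρ (X ⊗ Y) d g),
      E.ρ_comp_extTensor hX hY (Finset.HasAntidiagonal.mem_antidiagonal.mp ij.2) g, LinearMap.comp_apply]
  rw [hdec, map_sum]
  refine Finset.sum_congr rfl fun ij _ => ?_
  haveI := E.finite_obj hX ij.1.1
  haveI := E.finite_obj hY ij.1.2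
  have hid : E.kunnethComponent hX hY ij.1.1 ij.1.2 (Finset.HasAntidiagonal.mem_antidiagonal.mp ij.2) ∘ₗ
      E.extTensor (X := X) (Y := Y) (Finset.HasAntidiagonal.mem_antidiagonal.mp ij.2) = LinearMap.id :=
    LinearMap.ext fun t => E.kunnethComponent_extTensor_self hX hY _ t
  rw [LinearMap.trace_comp_comm', LinearMap.comp_assoc, hid, LinearMap.comp_id, LinearMap.trace_tensorProduct']

/-- **The Künneth formula for the traces of Frobenius: `tr(Fᵐ | Hᵈ(X × Y)) = Σ_{i+j=d} tr(Fᵐ | Hⁱ(X)) ·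
tr(Fᵐ | Hʲ(Y))`** (`Fᵐ = ρ(φ^{−m})`). [cite: Ramachandran2014, Theorem 2.1 (i) (second proof)] [cite: Deligne1974, (1.5)] -/
theorem frobTracePow_tensor_eq_sum (hX : IsSmoothProjective n X) (hY : IsSmoothProjective n' Y) (d m : ℕ) :
    E.frobTracePow (X ⊗ Y) d m =
      ∑ ij : ↥(Finset.HasAntidiagonal.antidiagonal d), E.frobTracePow X ij.1.1 m * E.frobTracePow Y ij.1.2 m := by
  simp only [frobTracePow_eq_trace_ρ]
  exact E.trace_ρ_tensor_eq_sum hX hY d (geomFrob k ^ m)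

/-- The same sum over the pairs `(i, j)`, `i ≤ 2n`, `j ≤ 2n'`, with `i + j = d` (the other Künneth pieces vanish:
`Hⁱ(X) = 0` for `i > 2n`). [cite: Kleiman1968AlgebraicCycles, §1.2 (A), (B)] -/
theorem frobTracePow_tensor_eq_sum_ite (hX : IsSmoothProjective n X) (hY : IsSmoothProjective n' Y) (d m : ℕ) :
    E.frobTracePow (X ⊗ Y) d m =
      ∑ i : Fin (2 * n + 1), ∑ j : Fin (2 * n' + 1),
        if (i : ℕ) + (j : ℕ) = d then E.frobTracePow X i m * E.frobTracePow Y j m else 0 := by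
  classical
  rw [E.frobTracePow_tensor_eq_sum hX hY d m,
    Finset.sum_coe_sort (Finset.HasAntidiagonal.antidiagonal d) (fun p : ℕ × ℕ => E.frobTracePow X p.1 m * E.frobTracePow Y p.2 m)]
  -- right side as a sum over the filtered product of ranges
  have hR : (∑ i : Fin (2 * n + 1), ∑ j : Fin (2 * n' + 1),
      if (i : ℕ) + (j : ℕ) = d then E.frobTracePow X i m * E.frobTracePow Y j m else 0) =
      ∑ p ∈ (Finset.range (2 * n + 1) ×ˢ Finset.range (2 * n' + 1)) with p.1 + p.2 = d,
        E.frobTracePow X p.1 m * E.frobTracePow Y p.2 m := by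
    rw [Finset.sum_filter, Finset.sum_product,
      Fin.sum_univ_eq_sum_range (fun i => ∑ j : Fin (2 * n' + 1),
        if i + (j : ℕ) = d then E.frobTracePow X i m * E.frobTracePow Y j m else 0)]
    refine Finset.sum_congr rfl fun i _ => ?_
    exact Fin.sum_univ_eq_sum_range (fun j => if i + j = d then E.frobTracePow X i m * E.frobTracePow Y j m else 0) _
  rw [hR]
  symm
  refine Finset.sum_subset (fun p hp => ?_) (fun p hp hp' => ?_)
  · rw [Finset.mem_filter] at hp
    exact Finset.HasAntidiagonal.mem_antidiagonal.mpr hp.2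
  · -- outside the ranges one of the traces vanishes
    rw [Finset.HasAntidiagonal.mem_antidiagonal] at hp
    rw [Finset.mem_filter, Finset.mem_product, Finset.mem_range, Finset.mem_range] at hp'
    have h : ¬(p.1 < 2 * n + 1 ∧ p.2 < 2 * n' + 1) := fun h' => hp' ⟨h', hp⟩
    rw [not_and_or, not_lt, not_lt] at h
    rcases h with h | h
    · rw [E.frobTracePow_eq_zero_of_lt hX (by omega), zero_mul]
    · rw [E.frobTracePow_eq_zero_of_lt hY (by omega), mul_zero]

/-! ### §2 `P_d(X × Y, T) = ∏_{i+j=d} det(1 − T·Fᵢ ⊗ F'ⱼ)` -/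

/-- **The Künneth formula for the Frobenius polynomials: `P_d(X × Y, T) = ∏_{i+j=d} det(1 − T·(Fᵢ ⊗ F'ⱼ) |
Hⁱ(X) ⊗ Hʲ(Y))`** in `K[T]` — both sides are `exp(−Σ_m tr(Fᵐ | Hᵈ(X × Y)) Tᵐ/m)` by §1 and Deligne's (1.5.3)
(«by the Künneth theorem, any `α_{X×Y}` is a product of a `α_X` and a `α_Y`», with multiplicity).
[cite: Ramachandran2014, Theorem 2.1 (i) (second proof)] [cite: Kahn2020, §3.6 axiom (vi)] [cite: Deligne1974, (1.5.3)–(1.5.4)] -/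
theorem frobCharPoly_tensor_eq_prod (hX : IsSmoothProjective n X) (hY : IsSmoothProjective n' Y) (d : ℕ) :
    E.frobCharPoly (X ⊗ Y) d = ∏ ij : ↥(Finset.HasAntidiagonal.antidiagonal d),
      (haveI := E.finite_obj hX ij.1.1; haveI := E.finite_obj hY ij.1.2;
        (TensorProduct.map (E.frobAction X ij.1.1) (E.frobAction Y ij.1.2)).charpoly.reverse) := by
  have hXY : IsSmoothProjective (n + n') (X ⊗ Y) := IsSmoothProjective.tensor_holds hX hY
  set L : ↥(Finset.HasAntidiagonal.antidiagonal d) → PowerSeries K := fun ij =>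
    PowerSeries.mk fun m => (m : ℚ)⁻¹ • (E.frobTracePow X ij.1.1 m * E.frobTracePow Y ij.1.2 m) with hLdef
  have hL : ∀ ij, constantCoeff (L ij) = 0 := fun ij => by
    rw [hLdef, ← coeff_zero_eq_constantCoeff_apply, coeff_mk, Nat.cast_zero, inv_zero, zero_smul]
  have hLn : ∀ ij, constantCoeff (-L ij) = 0 := fun ij => by rw [map_neg, hL, neg_zero]
  have hQ : ∀ ij : ↥(Finset.HasAntidiagonal.antidiagonal d),
      ((haveI := E.finite_obj hX ij.1.1; haveI := E.finite_obj hY ij.1.2;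
        (TensorProduct.map (E.frobAction X ij.1.1) (E.frobAction Y ij.1.2)).charpoly.reverse : K[X]) :
          PowerSeries K) = (PowerSeries.exp K).subst (-L ij) := by
    intro ij
    haveI := E.finite_obj hX ij.1.1
    haveI := E.finite_obj hY ij.1.2
    have h1 : (PowerSeries.exp K).subst (L ij) *
        ((TensorProduct.map (E.frobAction X ij.1.1) (E.frobAction Y ij.1.2)).charpoly.reverse : PowerSeries K) =
          1 := by
      rw [hLdef]
      exact exp_subst_mul_reverse_charpoly_map (E.frobAction X ij.1.1) (E.frobAction Y ij.1.2)
    have h2 := exp_subst_mul_exp_subst_neg (hL ij)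
    calc ((TensorProduct.map (E.frobAction X ij.1.1) (E.frobAction Y ij.1.2)).charpoly.reverse : PowerSeries K)
        = (PowerSeries.exp K).subst (L ij) * (PowerSeries.exp K).subst (-L ij) *
            ((TensorProduct.map (E.frobAction X ij.1.1) (E.frobAction Y ij.1.2)).charpoly.reverse :
              PowerSeries K) := by rw [h2, one_mul]
      _ = (PowerSeries.exp K).subst (-L ij) * ((PowerSeries.exp K).subst (L ij) *
            ((TensorProduct.map (E.frobAction X ij.1.1) (E.frobAction Y ij.1.2)).charpoly.reverse :
              PowerSeries K)) := by ring
      _ = (PowerSeries.exp K).subst (-L ij) := by rw [h1, mul_one]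
  -- `Σ_{ij} L ij = L_{X×Y,d}`
  have hsum : (PowerSeries.mk fun m => (m : ℚ)⁻¹ • E.frobTracePow (X ⊗ Y) d m) = ∑ ij, L ij := by
    ext m
    rw [coeff_mk, map_sum, E.frobTracePow_tensor_eq_sum hX hY d m, Finset.smul_sum]
    exact Finset.sum_congr rfl fun ij _ => by rw [hLdef, coeff_mk]
  apply Polynomial.coe_inj.mp
  rw [E.frobCharPoly_eq_exp_subst_neg hXY d, hsum, ← Polynomial.coeToPowerSeries.ringHom_apply, map_prod,
    ← Finset.sum_neg_distrib, exp_subst_sum _ _ fun ij _ => hLn ij]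
  refine Finset.prod_congr rfl fun ij _ => ?_
  rw [Polynomial.coeToPowerSeries.ringHom_apply]
  exact (hQ ij).symm

/-! ### §3 Integral models of `P_d(X × Y)` and the Riemann hypothesis for `X × Y` -/

section Integral

variable {F : Type*} [Field F]

/-- The roots of a finite product of non-zero polynomials, as a `Finset` sum of multisets. [folklore] -/
private theorem roots_finset_prod_eq_sum' {ι : Type*} [DecidableEq ι] (s : Finset ι) (f : ι → F[X])
    (h : ∀ i ∈ s, f i ≠ 0) : (∏ i ∈ s, f i).roots = ∑ i ∈ s, (f i).roots := by
  induction s using Finset.induction_on with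
  | empty => rw [Finset.prod_empty, Finset.sum_empty, Polynomial.roots_one]; rfl
  | insert a s ha ih =>
    have hs : ∀ i ∈ s, f i ≠ 0 := fun i hi => h i (Finset.mem_insert_of_mem hi)
    rw [Finset.prod_insert ha, Finset.sum_insert ha,
      Polynomial.roots_mul (mul_ne_zero (h a (Finset.mem_insert_self a s)) (Finset.prod_ne_zero_iff.mpr hs)),
      ih hs]

/-- Power sums over the roots of a finite product are the sums of the power sums. [folklore] -/
private theorem sum_roots_map_finset_prod' {ι : Type*} [DecidableEq ι] (s : Finset ι) (f : ι → F[X])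
    (h : ∀ i ∈ s, f i ≠ 0) (g : F → F) :
    ((∏ i ∈ s, f i).roots.map g).sum = ∑ i ∈ s, ((f i).roots.map g).sum := by
  rw [roots_finset_prod_eq_sum' s f h]
  induction s using Finset.induction_on with
  | empty => rw [Finset.sum_empty, Finset.sum_empty, Multiset.map_zero, Multiset.sum_zero]
  | insert a s ha ih =>
    rw [Finset.sum_insert ha, Finset.sum_insert ha, Multiset.map_add, Multiset.sum_add,
      ih fun i hi => h i (Finset.mem_insert_of_mem hi)]

end Integral

/-- A polynomial with constant coefficient `1` is non-zero. [folklore] -/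
private theorem ne_zero_of_coeff_zero_eq_one' {R : Type*} [Semiring R] [Nontrivial R] {P : R[X]}
    (h : P.coeff 0 = 1) : P ≠ 0 := fun h' => by
  rw [h', Polynomial.coeff_zero] at h
  exact zero_ne_one h

/-- **`|γ| = q^{−d/2}` for every complex root `γ` of `∏_{i+j=d} Pᵢ ⊙ P'ⱼ`** (`Pᵢ, P'ⱼ ∈ ℤ[T]` with constant
terms `1`, `i ≤ 2n`, `j ≤ 2n'`), when the complex roots of `Pᵢ` have absolute value `q^{−i/2}` and those of `P'ⱼ`
absolute value `q^{−j/2}`: a root of the composed multiplication `Pᵢ ⊙ P'ⱼ` (`RootProductsResultant`) is a product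
`z·w` of a root of `Pᵢ` and a root of `P'ⱼ` («any `α_{X×Y}` is a product of a `α_X` and a `α_Y`»,
`|α_X α_Y| = q^{(i+j)/2}` for the inverse roots).
[cite: Ramachandran2014, Theorem 2.1 (i) (second proof)] [cite: Deligne1974, Th. (1.6)] -/
theorem norm_eq_of_isRoot_prod_composedMul {q : ℝ} (hq : 0 < q) {PX : Fin (2 * n + 1) → ℤ[X]}
    {PY : Fin (2 * n' + 1) → ℤ[X]} (hPX0 : ∀ i, (PX i).coeff 0 = 1) (hPY0 : ∀ j, (PY j).coeff 0 = 1)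
    (hRX : ∀ (i : Fin (2 * n + 1)) (z : ℂ), ((PX i).map (Int.castRingHom ℂ)).IsRoot z →
      ‖z‖ = q ^ (-((i : ℕ) : ℝ) / 2))
    (hRY : ∀ (j : Fin (2 * n' + 1)) (w : ℂ), ((PY j).map (Int.castRingHom ℂ)).IsRoot w →
      ‖w‖ = q ^ (-((j : ℕ) : ℝ) / 2))
    (d : ℕ) {u : ℂ}
    (hu : ((∏ i : Fin (2 * n + 1), ∏ j : Fin (2 * n' + 1),
        if (i : ℕ) + (j : ℕ) = d then
          Polynomial.resultant ((PY j).reverse.map Polynomial.C)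
            (((PX i).map Polynomial.C).comp (Polynomial.C (Polynomial.X : ℤ[X]) * (Polynomial.X : ℤ[X][X])))
            (PY j).natDegree (PX i).natDegree
        else 1).map (Int.castRingHom ℂ)).IsRoot u) :
    ‖u‖ = q ^ (-(d : ℝ) / 2) := by
  classical
  set φ := Int.castRingHom ℂ with hφ_def
  have hinj : Function.Injective φ := (Int.castRingHom ℂ).injective_int
  set M : Fin (2 * n + 1) → Fin (2 * n' + 1) → ℤ[X] := fun i j =>
    Polynomial.resultant ((PY j).reverse.map Polynomial.C)
      (((PX i).map Polynomial.C).comp (Polynomial.C (Polynomial.X : ℤ[X]) * (Polynomial.X : ℤ[X][X])))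
      (PY j).natDegree (PX i).natDegree with hM_def
  -- `u` is a root of some factor `M i j` with `i + j = d`
  simp only [Polynomial.map_prod, Polynomial.IsRoot.def, Polynomial.eval_prod, Finset.prod_eq_zero_iff,
    Finset.mem_univ, true_and] at hu
  obtain ⟨i, j, hij⟩ := hu
  by_cases h : (i : ℕ) + (j : ℕ) = d
  · rw [if_pos h] at hij
    have hne : (M i j).map φ ≠ 0 := ne_zero_of_coeff_zero_eq_one'
      (by rw [Polynomial.coeff_map, coeff_zero_composedMul hinj (IsAlgClosed.splits _) (IsAlgClosed.splits _)
        (hPX0 i) (hPY0 j), map_one])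
    have hmem : u ∈ ((M i j).map φ).roots := (Polynomial.mem_roots hne).mpr hij
    rw [roots_map_composedMul hinj (IsAlgClosed.splits _) (IsAlgClosed.splits _) (hPX0 i) (hPY0 j),
      Multiset.mem_map] at hmem
    obtain ⟨zw, hzw, rfl⟩ := hmem
    obtain ⟨hz, hw⟩ := Multiset.mem_product.mp hzw
    have hXne : (PX i).map φ ≠ 0 := ne_zero_of_coeff_zero_eq_one' (by rw [Polynomial.coeff_map, hPX0 i, map_one])
    have hYne : (PY j).map φ ≠ 0 := ne_zero_of_coeff_zero_eq_one' (by rw [Polynomial.coeff_map, hPY0 j, map_one])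
    rw [norm_mul, hRX i zw.1 ((Polynomial.mem_roots hXne).mp hz), hRY j zw.2 ((Polynomial.mem_roots hYne).mp hw),
      ← Real.rpow_add hq, ← h, Nat.cast_add]
    congr 1
    ring
  · rw [if_neg h, Polynomial.map_one, Polynomial.eval_one] at hij
    exact absurd hij one_ne_zero

/-- **Integral models of `P_d(X × Y, T)` from integral models of the factors**: if `Pᵢ ∈ ℤ[T]` (`i ≤ 2n`) and
`P'ⱼ ∈ ℤ[T]` (`j ≤ 2n'`) are integral models of `det(1 − T·F | Hⁱ(X))`, `det(1 − T·F | Hʲ(Y))`, then for every `d`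
the product `∏_{i+j=d} Pᵢ ⊙ P'ⱼ` of composed multiplications (`RootProductsResultant`: the integral polynomial with
reciprocal roots the products `α_{ia} β_{jb}`) is an integral model of `det(1 − T·F | Hᵈ(X × Y))`: both have the
integral ghost components `tr(Fᵐ | Hᵈ(X × Y)) = Σ_{i+j=d} tr(Fᵢᵐ) tr(F'ⱼᵐ) = Σ_{i+j=d} (Σ_a α_{ia}^m)(Σ_b β_{jb}^m)`
(«any `α_{X×Y}` is a product of a `α_X` and a `α_Y`»).
[cite: Ramachandran2014, Theorem 2.1 (i) (second proof)] [cite: Deligne1974, (1.5) and Th. (1.6)] -/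
theorem isIntegralModel_tensor (hX : IsSmoothProjective n X) (hY : IsSmoothProjective n' Y)
    {PX : Fin (2 * n + 1) → ℤ[X]} (hPX : ∀ i : Fin (2 * n + 1), E.IsIntegralModel X i (PX i))
    {PY : Fin (2 * n' + 1) → ℤ[X]} (hPY : ∀ j : Fin (2 * n' + 1), E.IsIntegralModel Y j (PY j)) (d : ℕ) :
    E.IsIntegralModel (X ⊗ Y) d
      (∏ i : Fin (2 * n + 1), ∏ j : Fin (2 * n' + 1),
        if (i : ℕ) + (j : ℕ) = d then
          Polynomial.resultant ((PY j).reverse.map Polynomial.C)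
            (((PX i).map Polynomial.C).comp (Polynomial.C (Polynomial.X : ℤ[X]) * (Polynomial.X : ℤ[X][X])))
            (PY j).natDegree (PX i).natDegree
        else 1) := by
  classical
  have hXY : IsSmoothProjective (n + n') (X ⊗ Y) := IsSmoothProjective.tensor_holds hX hY
  set φ := Int.castRingHom ℂ with hφ_def
  have hinj : Function.Injective φ := (Int.castRingHom ℂ).injective_int
  have hPX0 : ∀ i, (PX i).coeff 0 = 1 := fun i => E.coeff_zero_eq_one_of_isIntegralModel (hPX i)
  have hPY0 : ∀ j, (PY j).coeff 0 = 1 := fun j => E.coeff_zero_eq_one_of_isIntegralModel (hPY j)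
  -- the composed multiplications
  set M : Fin (2 * n + 1) → Fin (2 * n' + 1) → ℤ[X] := fun i j =>
    Polynomial.resultant ((PY j).reverse.map Polynomial.C)
      (((PX i).map Polynomial.C).comp (Polynomial.C (Polynomial.X : ℤ[X]) * (Polynomial.X : ℤ[X][X])))
      (PY j).natDegree (PX i).natDegree with hM_def
  have hM0 : ∀ i j, (M i j).coeff 0 = 1 := fun i j =>
    coeff_zero_composedMul hinj (IsAlgClosed.splits _) (IsAlgClosed.splits _) (hPX0 i) (hPY0 j)
  have hMsum : ∀ i j (r : ℕ), (((M i j).map φ).roots.map fun u => u⁻¹ ^ r).sum =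
      (((PX i).map φ).roots.map fun z => z⁻¹ ^ r).sum * (((PY j).map φ).roots.map fun w => w⁻¹ ^ r).sum :=
    fun i j r => sum_roots_composedMul_inv_pow hinj (IsAlgClosed.splits _) (IsAlgClosed.splits _) (hPX0 i) (hPY0 j) r
  set PP : ℤ[X] := ∏ i : Fin (2 * n + 1), ∏ j : Fin (2 * n' + 1),
    if (i : ℕ) + (j : ℕ) = d then M i j else 1 with hPP_def
  have hF0 : ∀ (i : Fin (2 * n + 1)) (j : Fin (2 * n' + 1)),
      ((if (i : ℕ) + (j : ℕ) = d then M i j else 1) : ℤ[X]).coeff 0 = 1 := by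
    intro i j
    split_ifs
    · exact hM0 i j
    · exact Polynomial.coeff_one_zero
  have hFne' : ∀ (i : Fin (2 * n + 1)) (j : Fin (2 * n' + 1)),
      (((if (i : ℕ) + (j : ℕ) = d then M i j else 1) : ℤ[X]).map φ) ≠ 0 := by
    intro i j
    refine ne_zero_of_coeff_zero_eq_one' ?_
    rw [Polynomial.coeff_map, hF0 i j, map_one]
  have hPP0 : PP.coeff 0 = 1 := by
    rw [hPP_def, Polynomial.coeff_zero_prod]
    refine Finset.prod_eq_one fun i _ => ?_
    rw [Polynomial.coeff_zero_prod]
    exact Finset.prod_eq_one fun j _ => hF0 i j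
  -- the integral ghost components `N s = tr(F^{s+1} | Hᵈ(X × Y))`
  choose tX htXK htXC using fun (i : Fin (2 * n + 1)) (s : ℕ) => E.exists_int_frobTracePow_succ_eq_sum_roots hX (hPX i) s
  choose tY htYK htYC using fun (j : Fin (2 * n' + 1)) (s : ℕ) => E.exists_int_frobTracePow_succ_eq_sum_roots hY (hPY j) s
  set N : ℕ → ℤ := fun s => ∑ i : Fin (2 * n + 1), ∑ j : Fin (2 * n' + 1),
    if (i : ℕ) + (j : ℕ) = d then tX i s * tY j s else 0 with hN_def
  have hNK : ∀ s, E.frobTracePow (X ⊗ Y) d (s + 1) = (N s : K) := by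
    intro s
    rw [E.frobTracePow_tensor_eq_sum_ite hX hY d (s + 1), hN_def]
    push_cast
    refine Finset.sum_congr rfl fun i _ => Finset.sum_congr rfl fun j _ => ?_
    split_ifs
    · rw [htXK, htYK]
    · rfl
  have hNC : ∀ s, ((N s : ℤ) : ℂ) = ((PP.map φ).roots.map fun u => u⁻¹ ^ (s + 1)).sum := by
    intro s
    rw [hPP_def, Polynomial.map_prod, sum_roots_map_finset_prod' _ _ fun i _ => ?_]
    · rw [hN_def]
      push_cast
      refine Finset.sum_congr rfl fun i _ => ?_
      rw [Polynomial.map_prod, sum_roots_map_finset_prod' _ _ fun j _ => hFne' i j]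
      refine Finset.sum_congr rfl fun j _ => ?_
      split_ifs with h
      · rw [hMsum i j (s + 1), htXC, htYC]
      · rw [Polynomial.map_one, Polynomial.roots_one, Multiset.empty_eq_zero, Multiset.map_zero, Multiset.sum_zero]
    · rw [Polynomial.map_prod]
      exact Finset.prod_ne_zero_iff.mpr fun j _ => hFne' i j
  -- the logarithm over `ℚ`
  set Lq : PowerSeries ℚ := PowerSeries.mk fun m => (m : ℚ)⁻¹ * (N (m - 1) : ℚ) with hLq_def
  have hLq0 : constantCoeff Lq = 0 := by
    rw [hLq_def, ← coeff_zero_eq_constantCoeff_apply, coeff_mk, Nat.cast_zero, inv_zero, zero_mul]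
  -- over `ℂ`: `PP = exp(−Lq)`
  have hC : PowerSeries.map (algebraMap ℚ ℂ) ((PP.map (Int.castRingHom ℚ) : ℚ[X]) : PowerSeries ℚ) =
      PowerSeries.map (algebraMap ℚ ℂ) ((PowerSeries.exp ℚ).subst (-Lq)) := by
    have hmap : PowerSeries.map (algebraMap ℚ ℂ) ((PP.map (Int.castRingHom ℚ) : ℚ[X]) : PowerSeries ℚ) =
        ((PP.map φ : ℂ[X]) : PowerSeries ℂ) := by
      ext j
      simp [hφ_def, Polynomial.coeff_coe]
    have hA0 : (PP.map φ).coeff 0 = 1 := by rw [Polynomial.coeff_map, hPP0, map_one]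
    have hexp : PowerSeries.map (algebraMap ℚ ℂ) ((PowerSeries.exp ℚ).subst (-Lq)) =
        (PowerSeries.exp ℂ).subst (-(Lq.map (algebraMap ℚ ℂ))) := by
      have h := PowerSeries.map_subst (PowerSeries.HasSubst.of_constantCoeff_zero' (by rw [map_neg, hLq0, neg_zero]))
        (h := algebraMap ℚ ℂ) (PowerSeries.exp ℚ)
      rw [map_exp, map_neg] at h
      exact h
    rw [hmap, hexp, coe_eq_exp_subst_neg_of_splits hA0 (IsAlgClosed.splits _)]
    congr 2
    ext m
    rw [map_multiset_sum, Multiset.map_map, PowerSeries.coeff_map, hLq_def, coeff_mk]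
    have hcoe : ((PP.map φ).roots.map (((PowerSeries.coeff m) : PowerSeries ℂ →ₗ[ℂ] ℂ) ∘ fun z =>
        (PowerSeries.mk fun m => (m : ℚ)⁻¹ • z⁻¹ ^ m : PowerSeries ℂ))).sum =
        (m : ℚ)⁻¹ • ((PP.map φ).roots.map fun z => z⁻¹ ^ m).sum := by
      rw [Multiset.smul_sum, Multiset.map_map]
      exact congrArg _ (Multiset.map_congr rfl fun z _ => by simp only [Function.comp_apply, coeff_mk])
    rw [hcoe, map_mul, map_inv₀, map_natCast, eq_ratCast, Rat.smul_def, Rat.cast_inv, Rat.cast_natCast]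
    cases m with
    | zero => rw [Nat.cast_zero, inv_zero, zero_mul, zero_mul]
    | succ s => rw [Nat.add_sub_cancel, Rat.cast_intCast, hNC s]
  have hQ : ((PP.map (Int.castRingHom ℚ) : ℚ[X]) : PowerSeries ℚ) = (PowerSeries.exp ℚ).subst (-Lq) :=
    PowerSeries.map_injective (algebraMap ℚ ℂ) (algebraMap ℚ ℂ).injective hC
  -- over `K`: `P_d(X × Y) = exp(−Lq)` as well
  have hK : ((PP.map (Int.castRingHom K) : K[X]) : PowerSeries K) = (E.frobCharPoly (X ⊗ Y) d : PowerSeries K) := by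
    have hmap : ((PP.map (Int.castRingHom K) : K[X]) : PowerSeries K) =
        PowerSeries.map (algebraMap ℚ K) ((PP.map (Int.castRingHom ℚ) : ℚ[X]) : PowerSeries ℚ) := by
      ext j
      simp [Polynomial.coeff_coe]
    have hexp : PowerSeries.map (algebraMap ℚ K) ((PowerSeries.exp ℚ).subst (-Lq)) =
        (PowerSeries.exp K).subst (-(Lq.map (algebraMap ℚ K))) := by
      have h := PowerSeries.map_subst (PowerSeries.HasSubst.of_constantCoeff_zero' (by rw [map_neg, hLq0, neg_zero]))
        (h := algebraMap ℚ K) (PowerSeries.exp ℚ)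
      rw [map_exp, map_neg] at h
      exact h
    rw [hmap, hQ, hexp, E.frobCharPoly_eq_exp_subst_neg hXY d]
    congr 2
    ext m
    rw [PowerSeries.coeff_map, hLq_def, coeff_mk, coeff_mk, map_mul, map_inv₀, map_natCast, eq_ratCast,
      Rat.smul_def, Rat.cast_inv, Rat.cast_natCast]
    cases m with
    | zero => rw [Nat.cast_zero, inv_zero, zero_mul, zero_mul]
    | succ s => rw [Nat.add_sub_cancel, Rat.cast_intCast, hNK s]
  exact Polynomial.coe_inj.mp hK

/-- **The Riemann hypothesis for `X ×ₖ Y` from the Riemann hypothesis for `X` and for `Y`**: if the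
`Pᵢ(X, T)` and `Pⱼ(Y, T)` have integral models all of whose complex inverse roots have absolute values `q^{i/2}`,
`q^{j/2}` (`E.WeilRiemannHypothesisFor X n`, `E.WeilRiemannHypothesisFor Y n'`), then so do the `P_d(X ×ₖ Y, T)` in
dimension `n + n'` — the integral models `∏_{i+j=d} Pᵢ(X) ⊙ Pⱼ(Y)` of `isIntegralModel_tensor`, whose inverse roots are
the products `αβ`, `|αβ| = q^{(i+j)/2}` («by the Künneth theorem, any `α_{X×Y}` is a product of a `α_X` and a `α_Y`»).
The converse descent is the tree's `weilRiemannHypothesisFor_of_tensor`.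
[cite: Ramachandran2014, Theorem 2.1 (i) (second proof)] [cite: Deligne1974, Th. (1.6)] [cite: Kleiman1968AlgebraicCycles, §1.2 (B)] -/
theorem weilRiemannHypothesisFor_tensor (hX : IsSmoothProjective n X) (hY : IsSmoothProjective n' Y)
    (hRX : E.WeilRiemannHypothesisFor X n) (hRY : E.WeilRiemannHypothesisFor Y n') :
    E.WeilRiemannHypothesisFor (X ⊗ Y) (n + n') := by
  obtain ⟨PX, hPX, hRX⟩ := hRX
  obtain ⟨PY, hPY, hRY⟩ := hRY
  exact ⟨_, fun d => E.isIntegralModel_tensor hX hY hPX hPY d, fun d u hu =>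
    norm_eq_of_isRoot_prod_composedMul (by exact_mod_cast Nat.card_pos)
      (fun i => E.coeff_zero_eq_one_of_isIntegralModel (hPX i)) (fun j => E.coeff_zero_eq_one_of_isIntegralModel (hPY j))
      hRX hRY d hu⟩

/-- **Integral models of all the `P_d(X ×ₖ Y, T)` exist as soon as they exist for the factors** — the
rationality/integrality hypothesis on a product (e.g. `hint` of the tree's
`weilRiemannHypothesisFor_tensor_of_pushforward_ne_zero`) discharged from the factors.
[cite: Ramachandran2014, Theorem 2.1 (i) (second proof)] [cite: Deligne1974, (1.5.4)] -/
theorem exists_isIntegralModel_tensor (hX : IsSmoothProjective n X) (hY : IsSmoothProjective n' Y)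
    (hPX : ∀ i : Fin (2 * n + 1), ∃ P : ℤ[X], E.IsIntegralModel X i P)
    (hPY : ∀ j : Fin (2 * n' + 1), ∃ P : ℤ[X], E.IsIntegralModel Y j P) (d : ℕ) :
    ∃ P : ℤ[X], E.IsIntegralModel (X ⊗ Y) d P := by
  choose PX hPX using hPX
  choose PY hPY using hPY
  exact ⟨_, E.isIntegralModel_tensor hX hY hPX hPY d⟩

/-- **The Weil factorisation of `Z(X ×ₖ Y, T)` from the Riemann hypothesis for the factors**: if `E` satisfies the
Lefschetz trace formula and `χ(φ) = q`, and the `Pᵢ(X)`, `Pⱼ(Y)` have integral models whose complex roots have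
absolute values `q^{−i/2}`, `q^{−j/2}`, then `P_d := ∏_{i+j=d} Pᵢ(X) ⊙ Pⱼ(Y)` (`d ≤ 2(n + n')`) is a Weil
factorisation of `Z(X ×ₖ Y, T)` in the sense of `IsWeilFactorization` — `Z(X × Y, T) = ∏_d P_d^{(−1)^{d+1}}`,
`P₀ = 1 − T`, `P_{2(n+n')} = 1 − q^{n+n'}T`, `|γ| = q^{−d/2}` on the roots of `P_d`
(the tree's `isWeilFactorization_of_isIntegralModel` on `isIntegralModel_tensor`).
[cite: Ramachandran2014, Theorem 2.1 (i)] [cite: Deligne1974, (1.5.4) and Th. (1.6)] -/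
theorem isWeilFactorization_tensor (hE : E.HasLefschetzTraceFormula) (hχ : (χ (arithFrob k) : K) = Nat.card k)
    (hX : IsSmoothProjective n X) (hY : IsSmoothProjective n' Y)
    {PX : Fin (2 * n + 1) → ℤ[X]} (hPX : ∀ i : Fin (2 * n + 1), E.IsIntegralModel X i (PX i))
    {PY : Fin (2 * n' + 1) → ℤ[X]} (hPY : ∀ j : Fin (2 * n' + 1), E.IsIntegralModel Y j (PY j))
    (hRX : ∀ (i : Fin (2 * n + 1)) (z : ℂ), ((PX i).map (Int.castRingHom ℂ)).IsRoot z →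
      ‖z‖ = (Nat.card k : ℝ) ^ (-((i : ℕ) : ℝ) / 2))
    (hRY : ∀ (j : Fin (2 * n' + 1)) (w : ℂ), ((PY j).map (Int.castRingHom ℂ)).IsRoot w →
      ‖w‖ = (Nat.card k : ℝ) ^ (-((j : ℕ) : ℝ) / 2)) :
    IsWeilFactorization (Nat.card k) (n + n') (zetaSeries (X ⊗ Y)) fun d : Fin (2 * (n + n') + 1) =>
      ∏ i : Fin (2 * n + 1), ∏ j : Fin (2 * n' + 1),
        if (i : ℕ) + (j : ℕ) = (d : ℕ) then
          Polynomial.resultant ((PY j).reverse.map Polynomial.C)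
            (((PX i).map Polynomial.C).comp (Polynomial.C (Polynomial.X : ℤ[X]) * (Polynomial.X : ℤ[X][X])))
            (PY j).natDegree (PX i).natDegree
        else 1 :=
  isWeilFactorization_of_isIntegralModel E hE hχ (IsSmoothProjective.tensor_holds hX hY)
    (fun d => E.isIntegralModel_tensor hX hY hPX hPY d) fun d u hu =>
    norm_eq_of_isRoot_prod_composedMul (by exact_mod_cast Nat.card_pos)
      (fun i => E.coeff_zero_eq_one_of_isIntegralModel (hPX i)) (fun j => E.coeff_zero_eq_one_of_isIntegralModel (hPY j))
      hRX hRY d hu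

/-! ### §4 Degree one: `P₁(X × Y, T) = P₁(X, T) · P₁(Y, T)` with no hypothesis beyond `χ(φ) = q` -/

/-- **`tr(Fᵐ | H¹(X × Y)) = tr(Fᵐ | H¹(X)) + tr(Fᵐ | H¹(Y))`**: the `d = 1` case of the Künneth trace formula
`frobTracePow_tensor_eq_sum` (the antidiagonal of `1` is `{(0,1), (1,0)}`), `F` acting trivially on the lines
`H⁰(X)`, `H⁰(Y)` when `χ(φ) = q` (`frobTracePow_zero`).
[cite: Ramachandran2014, Theorem 2.1 (i) (second proof)] [cite: Deligne1974, (1.5) and (2.3)–(2.5)] -/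
theorem frobTracePow_tensor_one (hχ : (χ (arithFrob k) : K) = Nat.card k) (hX : IsSmoothProjective n X)
    (hY : IsSmoothProjective n' Y) (m : ℕ) :
    E.frobTracePow (X ⊗ Y) 1 m = E.frobTracePow X 1 m + E.frobTracePow Y 1 m := by
  classical
  rw [E.frobTracePow_tensor_eq_sum hX hY 1 m,
    Finset.sum_coe_sort (Finset.HasAntidiagonal.antidiagonal 1)
      (fun p : ℕ × ℕ => E.frobTracePow X p.1 m * E.frobTracePow Y p.2 m),
    Finset.Nat.sum_antidiagonal_eq_sum_range_succ_mk, Finset.sum_range_succ, Finset.sum_range_one,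
    Nat.sub_zero, Nat.sub_self, E.frobTracePow_zero hχ hX, E.frobTracePow_zero hχ hY, one_mul, mul_one, add_comm]

/-- **`P₁(X ×ₖ Y, T) = P₁(X, T) · P₁(Y, T)`** in `K[T]` for `X`, `Y` smooth projective and `χ(φ) = q` — the `d = 1`
case of the Künneth product formula `frobCharPoly_tensor_eq_prod` (`det(1 − T·F₀ ⊗ F'₁) = P₁(Y)`,
`det(1 − T·F₁ ⊗ F'₀) = P₁(X)` as `F₀ = 1` on the lines `H⁰`); here through the ghost components
`frobTracePow_tensor_one` and `P = exp(−Σ tr(Fᵐ) Tᵐ/m)`.  Unconditional form of the numerical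
`frobCharPoly_tensor_one` of `PointCountsKunnethReciprocalRoots` (which assumes the trace formula and the Riemann
hypothesis for `X`, `Y`, `X × Y`).
[cite: Ramachandran2014, Theorem 2.1 (i) (second proof)] [cite: Kleiman1968AlgebraicCycles, §1.2 (B)]
[cite: Deligne1974, (1.5.3) and (2.3)–(2.5)] -/
theorem frobCharPoly_tensor_one_eq_mul (hχ : (χ (arithFrob k) : K) = Nat.card k)
    (hX : IsSmoothProjective n X) (hY : IsSmoothProjective n' Y) :
    E.frobCharPoly (X ⊗ Y) 1 = E.frobCharPoly X 1 * E.frobCharPoly Y 1 := by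
  have hXY : IsSmoothProjective (n + n') (X ⊗ Y) := IsSmoothProjective.tensor_holds hX hY
  have h0 : ∀ (Z : SchemeOver k), constantCoeff (-PowerSeries.mk fun m => (m : ℚ)⁻¹ • E.frobTracePow Z 1 m) = 0 :=
    fun Z => by
      rw [map_neg, ← coeff_zero_eq_constantCoeff_apply, coeff_mk, Nat.cast_zero, inv_zero, zero_smul, neg_zero]
  have hsum : (-PowerSeries.mk fun m => (m : ℚ)⁻¹ • E.frobTracePow (X ⊗ Y) 1 m) =
      (-PowerSeries.mk fun m => (m : ℚ)⁻¹ • E.frobTracePow X 1 m) +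
        -PowerSeries.mk fun m => (m : ℚ)⁻¹ • E.frobTracePow Y 1 m := by
    ext m
    simp only [map_neg, map_add, coeff_mk, E.frobTracePow_tensor_one hχ hX hY m, smul_add, neg_add]
  apply Polynomial.coe_inj.mp
  rw [Polynomial.coe_mul, E.frobCharPoly_eq_exp_subst_neg hXY 1, E.frobCharPoly_eq_exp_subst_neg hX 1,
    E.frobCharPoly_eq_exp_subst_neg hY 1, hsum, exp_subst_add (h0 X) (h0 Y)]

/-- **Integral models in degree one multiply**: if `P, P' ∈ ℤ[T]` are integral models of `P₁(X, T)`, `P₁(Y, T)`,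
then `P · P'` is an integral model of `P₁(X ×ₖ Y, T)` (`χ(φ) = q`; no trace formula, no Riemann hypothesis).
[cite: Ramachandran2014, Theorem 2.1 (i) (second proof)] [cite: Deligne1974, (1.5.3)] -/
theorem isIntegralModel_tensor_one_mul (hχ : (χ (arithFrob k) : K) = Nat.card k)
    (hX : IsSmoothProjective n X) (hY : IsSmoothProjective n' Y) {P P' : ℤ[X]} (hP : E.IsIntegralModel X 1 P)
    (hP' : E.IsIntegralModel Y 1 P') : E.IsIntegralModel (X ⊗ Y) 1 (P * P') := by
  have h : P.map (Int.castRingHom K) = E.frobCharPoly X 1 := hP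
  have h' : P'.map (Int.castRingHom K) = E.frobCharPoly Y 1 := hP'
  show (P * P').map (Int.castRingHom K) = E.frobCharPoly (X ⊗ Y) 1
  rw [Polynomial.map_mul, h, h', E.frobCharPoly_tensor_one_eq_mul hχ hX hY]

end GaloisWeilCohomology

end Literature.AlgebraicGeometry.Motives
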